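import Mathlib
import Summits.PneNP.PneNP.Theorems.KarlinRubinMonotoneSufficesTransportSlices

/-!
# Crux `MonotoneSuffices` (stmt-PneNP-18026), line `Sketch` — density-shift rung, stub
# `stub_shiftCount` (W1): the exact law of the up-shifted input

On the cube `α → Bool` (`supp x = {a | x a}`) the UP-SHIFT by a set `R` is
`x ↦ x ∨ 1_R = fun a => x a || [a ∈ R]`.  Double counting the pairs `(x, R)` with `#R = r`:

* `shiftCount_card_filter_shift_mem` — for a fixed `R`, `#{x | x ∨ 1_R ∈ A} = 2^{#R} · #{y ∈ A | R ⊆ supp y}`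
  (the fibre of the shift over `y` is `2^{#R}` vectors if `R ⊆ supp y`, by
  `SliceTransport.card_filter_plant_eq`, and empty otherwise since `R ⊆ supp (x ∨ 1_R)`);
* `shiftCount_card_filter_powersetCard_subset` — for a fixed `y`, the `r`-sets inside `supp y` number
  `C(#supp y, r)`;
* `stub_shiftCount` — summing over all `r`-sets `R`,
  `∑_R #{x | x ∨ 1_R ∈ A} = 2^r · ∑_{y ∈ A} C(#supp y, r)`.
-/

set_option linter.dupNamespace false -- `Summit.PneNP.PneNP.…`: summit = sub-problem name (D-0017)

namespace Summit.PneNP.PneNP.Theorems.MonotoneSuffices.DensityShift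

open Finset

variable {α : Type*} [Fintype α] [DecidableEq α]

/-- **The shift by a fixed `R` is `2^{#R}`-to-one onto the vectors containing `R`**:
`#{x | x ∨ 1_R ∈ A} = 2^{#R} · #{y ∈ A | R ⊆ supp y}`. [folklore] -/
theorem shiftCount_card_filter_shift_mem (A : Finset (α → Bool)) (R : Finset α) :
    #((univ : Finset (α → Bool)).filter fun x => (fun a => x a || decide (a ∈ R)) ∈ A) =
      2 ^ #R * #(A.filter fun y => R ⊆ univ.filter fun a => y a = true) := by
  classical
  have hmaps : (((univ : Finset (α → Bool)).filter
      fun x => (fun a => x a || decide (a ∈ R)) ∈ A) : Set (α → Bool)).MapsTo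
      (fun x => fun a => x a || decide (a ∈ R)) A := fun x hx =>
    (mem_filter.1 (mem_coe.1 hx)).2
  rw [card_eq_sum_card_fiberwise hmaps, card_filter, mul_sum]
  refine sum_congr rfl fun y hy => ?_
  by_cases hRy : R ⊆ univ.filter fun a => y a = true
  · rw [if_pos hRy, mul_one, ← SliceTransport.card_filter_plant_eq hRy]
    congr 1
    ext x
    simp only [mem_filter, mem_univ, true_and, and_iff_right_iff_imp]
    intro hxy
    rwa [hxy]
  · rw [if_neg hRy, mul_zero, card_eq_zero, filter_eq_empty_iff]
    intro x _ hxy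
    apply hRy
    rw [← hxy]
    exact SliceTransport.subset_filter_plant x R

omit [Fintype α] in
/-- **The `r`-subsets of `U` lying inside `S ⊆ U` number `C(#S, r)`**:
`#{R ∈ U.powersetCard r | R ⊆ S} = #(S.powersetCard r) = C(#S, r)` (used with `U = univ`,
`S = supp y`). [folklore] -/
theorem shiftCount_card_filter_powersetCard_subset (U S : Finset α) (hSU : S ⊆ U) (r : ℕ) :
    #((U.powersetCard r).filter fun R => R ⊆ S) = (#S).choose r := by
  rw [← card_powersetCard]
  congr 1
  ext R
  simp only [mem_filter, mem_powersetCard]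
  exact ⟨fun h => ⟨h.2, h.1.2⟩, fun h => ⟨⟨h.1.trans hSU, h.2⟩, h.1⟩⟩

/-- **W1, the law of the up-shift** (registered stub of stmt-PneNP-18026, line `Sketch`,
density-shift rung): the pairs `(x, R)` with `#R = r` and `x ∨ 1_R = y` number `2^r · C(#supp y, r)`,
so `∑_{#R = r} #{x | x ∨ 1_R ∈ A} = 2^r · ∑_{y ∈ A} C(#supp y, r)`. [folklore] -/
theorem stub_shiftCount :
    ∀ {α : Type*} [Fintype α] [DecidableEq α] (A : Finset (α → Bool)) (r : ℕ),
      ∑ R ∈ (univ : Finset α).powersetCard r,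
          #((univ : Finset (α → Bool)).filter fun x => (fun a => x a || decide (a ∈ R)) ∈ A) =
        2 ^ r * ∑ y ∈ A, (#(univ.filter fun a => y a = true)).choose r := by
  intro α _ _ A r
  calc ∑ R ∈ (univ : Finset α).powersetCard r,
          #((univ : Finset (α → Bool)).filter fun x => (fun a => x a || decide (a ∈ R)) ∈ A)
      = ∑ R ∈ (univ : Finset α).powersetCard r,
          2 ^ r * ∑ y ∈ A, if R ⊆ univ.filter (fun a => y a = true) then 1 else 0 := by
        refine sum_congr rfl fun R hR => ?_
        rw [shiftCount_card_filter_shift_mem, (mem_powersetCard.1 hR).2, card_filter]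
    _ = 2 ^ r * ∑ y ∈ A, ∑ R ∈ (univ : Finset α).powersetCard r,
          if R ⊆ univ.filter (fun a => y a = true) then 1 else 0 := by
        rw [← mul_sum, sum_comm]
    _ = 2 ^ r * ∑ y ∈ A, (#(univ.filter fun a => y a = true)).choose r := by
        congr 1
        refine sum_congr rfl fun y _ => ?_
        rw [← card_filter]
        exact shiftCount_card_filter_powersetCard_subset univ _ (subset_univ _) r

end Summit.PneNP.PneNP.Theorems.MonotoneSuffices.DensityShift
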